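import Literature.Geometry.Kaehler.ComplexTorusHardLefschetzMinimalClassModPrime
import HarnessLib

/-!
# The Lefschetz operator of the minimal class `γ_{g−2}` on `H²(X, ℤ/p)`: injective iff surjective (every type); for a constant type
# `[H^{2g−2}(X, ℤ) : γ_{g−2} ∧ H²(X, ℤ) + N·H^{2g−2}(X, ℤ)] = gcd(N, g−1)` and, for `p ∣ g − 1`, the kernel mod `p` is the LINE OF `θ`

Layer `Literature/Geometry/Kaehler`, namespace `Literature.Geometry.Kaehler.ComplexTorus`; lane `lit-hodgefound` (Track 2
foundations library), seat p09, generation 41, row g41-#2. THEOREMS ONLY (0 definitions); no named fact, net debt 0. Sequel of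
g40-#6 `ComplexTorusIntegralHardLefschetzMinimalClassDegreeTwo` (`[H^{2g−2}(X, ℤ) : γ_{g−2} ∧ H²(X, ℤ)] = (g−1)·∏_i ((d_{g−1}/d_i)(d_g/d_i))^{2g−1}`;
for a constant type the cokernel is `ℤ/(g−1)`, generated by the minimal curve class `γ_{g−1}`, of order `g − 1`) and g40-#8
`ComplexTorusHardLefschetzMinimalClassModPrime` (`γ_{g−2} ∧ H²(X, ℤ) + p·H^{2g−2}(X, ℤ) = H^{2g−2}(X, ℤ)` iff `p ∤ (g−1)·d_g/d₁`).

Sources (the statements being made precise over `ℤ` and `ℤ/p`):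

* Lange 2023 §5.4.1 Thm. 5.4.1 and (5.22) (PDF p. 275: hard Lefschetz `L^{g−2} : H² ⥲ H^{2g−2}` over `ℂ`); §2.5.3 Thm. 2.5.16 / Cor. 2.5.17
  (PDF p. 135: `∧^q θ = q! Σ_T (∏_{ν∈T} d_ν) ω_T`); §4.2 Poincaré's formula (PDF p. 204); §1.5.1 (PDF p. 51: types; all lattice values of a
  form of type `d` lie in `d₁ℤ`, so `θ/d₁ ∈ H²(X, ℤ)`); §1.1.3 Exercise 1.1.6 (8) (`Hᵏ(X, ℤ)` free of rank `C(2g, k)`);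
* Voisin 2002 §6.2.3 Thm. 6.25 (PDF p. 125) and §7.1.2 (PDF p. 134 L31: `L` acts on integral cohomology; hard Lefschetz fails over `ℤ`);
* Benoist–Debarre 2023 §1 (p. 3): the minimal class `θ^c/c!` of a principally polarised abelian variety.

## Setting and contents (`g = j + 2`, `θ = ofRealForm η`, symplectic enumeration `e₀` of type `d₁ ∣ ⋯ ∣ d_g`, minimal class `γ = γ_{g−2}`,
## `θ^{∧(g−2)} = ((g−2)!·d₁⋯d_{g−2})·γ`; `H² = H²(X, ℤ)`, `H = H^{2g−2}(X, ℤ)`, `S = γ ∧ H² ⊆ H`)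

Since `H^•(X, ℤ)` is torsion-free, `Hᵏ(X, ℤ/N) = Hᵏ(X, ℤ)/N` and the Lefschetz operator `γ ∪ (−) : H²(X, ℤ/N) → H^{2g−2}(X, ℤ/N)` has
IMAGE `(S + N·H)/N·H` and KERNEL `K_N/N·H²`, `K_N := {x ∈ H² : γ ∧ x ∈ N·H}` — in the tree's vocabulary the subgroups
`S ⊔ H.map (nsmulAddMonoidHom N)` and `H² ⊓ (H.map (nsmulAddMonoidHom N)).comap (γ ∧ ·)`.

* §0 (private) `[H² : K_N] = [S + N·H : N·H]` (`K_N` is the pull-back of `N·H` under the injective `γ ∧ (−)`), and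
  `[H² : N·H²] = [H : N·H] = N^{C(2g,2)}` (`rk H² = rk H^{2g−2}`).
* §1 EVERY TYPE. **`K_N = N·H²` iff `S + N·H = H`** (`N ≥ 1`): `γ ∪ (−)` on `ℤ/N`-cohomology is injective iff it is surjective — both sides
  have `N^{C(2g,2)}` elements (`IsSymplecticEnum.inf_comap_map_nsmul_eq_iff_sup_map_nsmul_eq_of_eq_content_smul`); with g40-#8, for a prime
  `p` and `g ≥ 3`: **`γ_{g−2} ∪ (−)` is injective on `H²(X, ℤ/p)` iff `p ∤ g − 1` and `p ∤ d_g/d₁`** (`…_inf_comap_map_nsmul_eq_map_nsmul_iff_…`).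
* §2 CONSTANT TYPE `(k, …, k)` (e.g. a principal polarisation). **`[H : S + N·H] = gcd(N, g−1)` for every `N`**
  (`IsSymplecticEnum.relIndex_map_wedge_integralForms_two_sup_map_nsmul_of_forall_eq`): `H = S + ℤγ_{g−1}` with `γ_{g−1}` of order `g − 1`
  modulo `S` (g40-#6), so `S + N·H = S + ℤ·Nγ_{g−1}` and `k γ_{g−1} ∈ S + ℤ·Nγ_{g−1} ⟺ gcd(N, g−1) ∣ k` (Bézout); i.e. the cokernel of
  `γ ∪ (−)` on `H²(X, ℤ/N)` is `ℤ/gcd(N, g−1)`.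
* §3 CONSTANT TYPE, `p` prime, `p ∣ g − 1`. **`[K_p : p·H²] = p`** — the kernel of `γ_{g−2} ∪ (−)` on `H²(X, ℤ/p)` is a line — and
  **`K_p = ℤ·(θ/d₁) + p·H²(X, ℤ)`: the kernel is the line spanned by the polarisation** (`θ/d₁ ∈ H²(X, ℤ)` is primitive, and
  `γ_{g−2} ∧ θ/d₁ = (g−1)·γ_{g−1} ∈ p·H`); index bookkeeping: `[H² : K_p] = [S + pH : pH] = p^{C(2g,2)}/[H : S + pH] = p^{C(2g,2)−1}`
  (`IsSymplecticEnum.relIndex_map_nsmul_inf_comap_of_forall_eq`, `IsSymplecticEnum.inf_comap_map_nsmul_eq_zmultiples_sup_of_forall_eq`,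
  membership form `…wedge_mem_map_nsmul_iff_of_forall_eq`). For a principally polarised `X` of dimension `g ≥ 3` and `p ∣ g − 1`:
  `ker (θ^{g−2}/(g−2)! ∪ (−) : H²(X, 𝔽_p) → H^{2g−2}(X, 𝔽_p)) = 𝔽_p · θ̄`.
* §4 the same on any presentation of the polarised torus (`IsPolarizationType.…`).

## References

* [cite: Lange2023AbelianVarietiesComplex, §5.4.1 Thm. 5.4.1 and (5.22) (PDF p. 275); §2.5.3 Thm. 2.5.16 and Cor. 2.5.17 (PDF p. 135);
  §4.2 (PDF p. 204); §1.5.1 (PDF p. 51); §1.1.3 Lemma 1.1.17 and Exercise 1.1.6 (8); §2.1.1]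
* [cite: VoisinHodgeI2002, §6.2.3 Thm. 6.25 (PDF p. 125); §7.1.2 (PDF p. 134 L31)]
* [cite: BenoistDebarre2023SmoothSubvarietiesJacobians, §1 (p. 3)]
-/

noncomputable section

open Module Function
open Literature.LinearAlgebra.Alternating

namespace Literature.Geometry.Kaehler.ComplexTorus

section ModPrimeKernel

/-! ## §0 Lattice bookkeeping (private) -/

/-- `[H₂ : H₂ ∩ L⁻¹(T)] = [L(H₂) : L(H₂) ∩ T]`: the index of a pull-back is the index in the image. [folklore] -/
private theorem relIndex_inf_comap₄₃ {G G' : Type*} [AddCommGroup G] [AddCommGroup G'] (L : G →+ G') (H₂ : AddSubgroup G)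
    (T : AddSubgroup G') : (H₂ ⊓ T.comap L).relIndex H₂ = T.relIndex (H₂.map L) := by
  rw [inf_comm, AddSubgroup.inf_relIndex_right, AddSubgroup.relIndex_comap]

/-- From `a · x = c = a · y` (as `x · a = c` and `y · a = c`) with `c ≠ 0`: `x = y`. [folklore] -/
private theorem eq_of_mul_eq_of_mul_eq₄₃ {a x y c : ℕ} (hc : c ≠ 0) (hx : x * a = c) (hy : y * a = c) : x = y := by
  have ha : 0 < a := Nat.pos_of_ne_zero fun h0 ↦ hc (by rw [← hx, h0, mul_zero])
  exact Nat.eq_of_mul_eq_mul_right ha (hx.trans hy.symm)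

variable {ι : Type*} [Fintype ι] [DecidableEq ι] {E : Type*} [NormedAddCommGroup E] [NormedSpace ℂ E]
  (Φ : (ι → ℝ) ≃L[ℝ] E) {j : ℕ} {e₀ : Fin (j + 2) ⊕ Fin (j + 2) ≃ ι} {η : E [⋀^Fin 2]→L[ℝ] ℝ} {d : Fin (j + 2) → ℕ}

omit [DecidableEq ι] in
/-- `[H²(X, ℤ) : N·H²(X, ℤ)] = N^{C(2g,2)}` (`H²(X, ℤ)` is free of rank `C(2g, 2)`). [cite: Lange2023AbelianVarietiesComplex, §1.1.3 Exercise 1.1.6 (8)] -/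
private theorem relIndex_map_nsmul_integralForms_two₄₃ (N : ℕ) :
    ((integralForms Φ 2).map (nsmulAddMonoidHom N)).relIndex (integralForms Φ 2) = N ^ (Fintype.card ι).choose 2 := by
  haveI := free_integralForms Φ 2
  haveI := finite_integralForms Φ 2
  rw [AddSubgroup.relIndex_map_nsmul]
  congr 1
  exact finrank_integralForms_eq_choose Φ 2

omit [DecidableEq ι] in
/-- `[H^{2g−2}(X, ℤ) : N·H^{2g−2}(X, ℤ)] = N^{C(2g,2)}` (`rk H^{2g−2} = C(2g, 2g−2) = C(2g, 2)`; `g = j + 2`).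
[cite: Lange2023AbelianVarietiesComplex, §1.1.3 Exercise 1.1.6 (8)] -/
private theorem relIndex_map_nsmul_integralForms_codegree_two₄₃ (e : Fin (2 * (j + 2)) ≃ ι) (N : ℕ) :
    ((integralForms Φ (2 * j + 2)).map (nsmulAddMonoidHom N)).relIndex (integralForms Φ (2 * j + 2)) = N ^ (Fintype.card ι).choose 2 := by
  haveI := free_integralForms Φ (2 * j + 2)
  haveI := finite_integralForms Φ (2 * j + 2)
  rw [AddSubgroup.relIndex_map_nsmul]
  congr 1
  refine (finrank_integralForms_eq_choose Φ (2 * j + 2)).trans ?_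
  rw [← Fintype.card_congr e, Fintype.card_fin, show 2 * (j + 2) = 2 + (2 * j + 2) by ring]
  exact (Nat.choose_symm_add).symm

/-! ## §1 Every type: `γ_{g−2} ∪ (−)` on `H²(X, ℤ/N)` is injective iff it is surjective -/

/-- **Injective iff surjective modulo `N`, every type.** For a Riemann form with a symplectic enumeration of type `(d₁, …, d_g)` (`g = j + 2`),
the minimal class `γ = γ_{g−2}` (`θ^{∧(g−2)} = ((g−2)!·d₁⋯d_{g−2})·γ`) and `N ≥ 1`: the pull-back
`K_N = {x ∈ H²(X, ℤ) : γ ∧ x ∈ N·H^{2g−2}(X, ℤ)}` equals `N·H²(X, ℤ)` — `γ ∪ (−) : H²(X, ℤ/N) → H^{2g−2}(X, ℤ/N)` is INJECTIVE — iff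
`γ ∧ H²(X, ℤ) + N·H^{2g−2}(X, ℤ) = H^{2g−2}(X, ℤ)` — it is SURJECTIVE. (Both `H²(X, ℤ/N)` and `H^{2g−2}(X, ℤ/N)` have `N^{C(2g,2)}` elements and
`γ ∧ (−)` is injective over `ℤ` by hard Lefschetz: `[H² : K_N] = [γ∧H² + N·H : N·H] = N^{C(2g,2)}/[H : γ∧H² + N·H]`.)
[cite: Lange2023AbelianVarietiesComplex, §5.4.1 Thm. 5.4.1 and (5.22) (PDF p. 275); §2.5.3 Cor. 2.5.17 (PDF p. 135); §1.1.3 Exercise 1.1.6 (8)] [cite: VoisinHodgeI2002, §6.2.3 Thm. 6.25 (PDF p. 125); §7.1.2 (PDF p. 134 L31)] -/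
theorem IsSymplecticEnum.inf_comap_map_nsmul_eq_iff_sup_map_nsmul_eq_of_eq_content_smul (h : IsSymplecticEnum Φ e₀ η d)
    (hη : IsRiemannForm Φ η) (hle : j ≤ j + 2) {γ : E [⋀^Fin (2 * j)]→L[ℝ] ℂ}
    (hγ : wedgePow (ofRealForm η) j = ((j.factorial * ∏ i : Fin j, d (Fin.castLE hle i) : ℕ) : ℂ) • γ) {N : ℕ} (hN : N ≠ 0) :
    integralForms Φ 2 ⊓ ((integralForms Φ (2 * j + 2)).map (nsmulAddMonoidHom N)).comap
        (AddMonoidHom.mk' (fun x : E [⋀^Fin 2]→L[ℝ] ℂ ↦ γ.wedge x) (ContinuousAlternatingMap.wedge_add_right _)) =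
      (integralForms Φ 2).map (nsmulAddMonoidHom N) ↔
    (integralForms Φ 2).map (AddMonoidHom.mk' (fun x : E [⋀^Fin 2]→L[ℝ] ℂ ↦ γ.wedge x)
        (ContinuousAlternatingMap.wedge_add_right _)) ⊔ (integralForms Φ (2 * j + 2)).map (nsmulAddMonoidHom N) =
      integralForms Φ (2 * j + 2) := by
  classical
  set L : (E [⋀^Fin 2]→L[ℝ] ℂ) →+ (E [⋀^Fin (2 * j + 2)]→L[ℝ] ℂ) := AddMonoidHom.mk'
    (fun x : E [⋀^Fin 2]→L[ℝ] ℂ ↦ γ.wedge x) (ContinuousAlternatingMap.wedge_add_right _) with hL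
  set H₂ := integralForms Φ 2 with hH₂
  set H := integralForms Φ (2 * j + 2) with hH
  set S := H₂.map L with hS
  set NH := H.map (nsmulAddMonoidHom N) with hNH
  set NH₂ := H₂.map (nsmulAddMonoidHom N) with hNH₂
  have hSH : S ≤ H := h.map_wedge_integralForms_two_le_of_eq_content_smul Φ hη hle hγ
  have hNHH : NH ≤ H := by
    rintro _ ⟨x, hx, rfl⟩
    exact H.nsmul_mem hx N
  have hNH₂K : NH₂ ≤ H₂ ⊓ NH.comap L := by
    rintro _ ⟨x, hx, rfl⟩
    refine AddSubgroup.mem_inf.2 ⟨H₂.nsmul_mem hx N, ?_⟩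
    rw [AddSubgroup.mem_comap, nsmulAddMonoidHom_apply, map_nsmul]
    exact ⟨L x, hSH ⟨x, hx, rfl⟩, rfl⟩
  have hpow : N ^ (Fintype.card ι).choose 2 ≠ 0 := pow_ne_zero _ hN
  have hidx₂ : NH₂.relIndex H₂ = N ^ (Fintype.card ι).choose 2 := relIndex_map_nsmul_integralForms_two₄₃ Φ N
  have hidx : NH.relIndex H = N ^ (Fintype.card ι).choose 2 := relIndex_map_nsmul_integralForms_codegree_two₄₃ Φ (ilvEnum e₀) N
  -- `[H₂ : K] = [S + NH : NH]`
  have hKidx : (H₂ ⊓ NH.comap L).relIndex H₂ = NH.relIndex (S ⊔ NH) := by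
    rw [relIndex_inf_comap₄₃, AddSubgroup.relIndex_sup_right]
  have hmul₁ : NH.relIndex (S ⊔ NH) * (S ⊔ NH).relIndex H = N ^ (Fintype.card ι).choose 2 := by
    rw [AddSubgroup.relIndex_mul_relIndex NH (S ⊔ NH) H le_sup_right (sup_le hSH hNHH), hidx]
  have hmul₂ : NH₂.relIndex (H₂ ⊓ NH.comap L) * (H₂ ⊓ NH.comap L).relIndex H₂ = N ^ (Fintype.card ι).choose 2 := by
    rw [AddSubgroup.relIndex_mul_relIndex NH₂ (H₂ ⊓ NH.comap L) H₂ hNH₂K inf_le_left, hidx₂]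
  constructor
  · intro hK
    have h1 : (H₂ ⊓ NH.comap L).relIndex H₂ = N ^ (Fintype.card ι).choose 2 := by rw [hK, hidx₂]
    rw [hKidx] at h1
    have h2 : (S ⊔ NH).relIndex H = 1 :=
      eq_of_mul_eq_of_mul_eq₄₃ hpow (by rw [mul_comm, h1] at hmul₁; exact hmul₁) (one_mul _)
    exact le_antisymm (sup_le hSH hNHH) (AddSubgroup.relIndex_eq_one.1 h2)
  · intro hsurj
    have h1 : NH.relIndex (S ⊔ NH) = N ^ (Fintype.card ι).choose 2 := by rw [hsurj, hidx]
    rw [← hKidx] at h1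
    rw [h1] at hmul₂
    have h2 : NH₂.relIndex (H₂ ⊓ NH.comap L) = 1 := eq_of_mul_eq_of_mul_eq₄₃ hpow hmul₂ (one_mul _)
    exact le_antisymm (AddSubgroup.relIndex_eq_one.1 h2) hNH₂K

/-- **`γ_{g−2} ∪ (−)` is injective on `H²(X, ℤ/p)` iff `p ∤ g − 1` and `p ∤ d_g/d₁`** (`g = j + 2 ≥ 3`, `p` prime, every type): by §1 and g40-#8
(surjective iff `p ∤ (g−1)·d_g/d₁`), `{x ∈ H²(X, ℤ) : γ_{g−2} ∧ x ∈ p·H^{2g−2}(X, ℤ)} = p·H²(X, ℤ)` iff `p ∤ g − 1 ∧ p ∤ d_g/d₁`. For a principal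
polarisation of dimension `g ≥ 3`: `θ^{g−2}/(g−2)! ∪ (−)` is injective on `H²(X, 𝔽_p)` iff `p ∤ g − 1`.
[cite: Lange2023AbelianVarietiesComplex, §5.4.1 Thm. 5.4.1 and (5.22) (PDF p. 275); §2.5.3 Thm. 2.5.16 and Cor. 2.5.17 (PDF p. 135); §1.5.1 (PDF p. 51)] [cite: VoisinHodgeI2002, §6.2.3 Thm. 6.25 (PDF p. 125); §7.1.2 (PDF p. 134 L31)] [cite: BenoistDebarre2023SmoothSubvarietiesJacobians, §1 (p. 3)] -/
theorem IsSymplecticEnum.inf_comap_map_nsmul_eq_map_nsmul_iff_of_eq_content_smul (h : IsSymplecticEnum Φ e₀ η d)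
    (hη : IsRiemannForm Φ η) (hj : 1 ≤ j) (hle : j ≤ j + 2) {γ : E [⋀^Fin (2 * j)]→L[ℝ] ℂ}
    (hγ : wedgePow (ofRealForm η) j = ((j.factorial * ∏ i : Fin j, d (Fin.castLE hle i) : ℕ) : ℂ) • γ) {p : ℕ} (hp : p.Prime) :
    integralForms Φ 2 ⊓ ((integralForms Φ (2 * j + 2)).map (nsmulAddMonoidHom p)).comap
        (AddMonoidHom.mk' (fun x : E [⋀^Fin 2]→L[ℝ] ℂ ↦ γ.wedge x) (ContinuousAlternatingMap.wedge_add_right _)) =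
      (integralForms Φ 2).map (nsmulAddMonoidHom p) ↔ ¬ p ∣ j + 1 ∧ ¬ p ∣ d (Fin.last (j + 1)) / d 0 := by
  rw [h.inf_comap_map_nsmul_eq_iff_sup_map_nsmul_eq_of_eq_content_smul Φ hη hle hγ hp.ne_zero,
    h.map_wedge_integralForms_two_sup_map_nsmul_eq_iff_of_eq_content_smul Φ hη hj hle hγ hp]

/-! ## §2 Constant type: `[H^{2g−2}(X, ℤ) : γ_{g−2} ∧ H²(X, ℤ) + N·H^{2g−2}(X, ℤ)] = gcd(N, g−1)` -/

/-- **Constant type `(k, …, k)` (e.g. a principal polarisation): `[H^{2g−2}(X, ℤ) : γ_{g−2} ∧ H²(X, ℤ) + N·H^{2g−2}(X, ℤ)] = gcd(N, g−1)` for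
every `N`** (`g = j + 2`) — the cokernel of `γ_{g−2} ∪ (−) : H²(X, ℤ/N) → H^{2g−2}(X, ℤ/N)` is cyclic of order `gcd(N, g−1)`. Proof:
`H^{2g−2} = γ∧H² + ℤγ_{g−1}` with the minimal curve class `γ_{g−1}` of order `g − 1` modulo `γ∧H²` (g40-#6), so `γ∧H² + N·H^{2g−2} = γ∧H² + ℤ·Nγ_{g−1}`,
and `k·γ_{g−1}` lies in it iff `gcd(N, g−1) ∣ k` (Bézout). [cite: Lange2023AbelianVarietiesComplex, §5.4.1 Thm. 5.4.1 and (5.22) (PDF p. 275); §4.2 (PDF p. 204); §2.5.3 Cor. 2.5.17 (PDF p. 135); §2.1.1] [cite: VoisinHodgeI2002, §7.1.2 (PDF p. 134 L31)] [cite: BenoistDebarre2023SmoothSubvarietiesJacobians, §1 (p. 3)] -/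
theorem IsSymplecticEnum.relIndex_map_wedge_integralForms_two_sup_map_nsmul_of_forall_eq (h : IsSymplecticEnum Φ e₀ η d)
    (hη : IsRiemannForm Φ η) (hle : j ≤ j + 2) {γ : E [⋀^Fin (2 * j)]→L[ℝ] ℂ}
    (hγ : wedgePow (ofRealForm η) j = ((j.factorial * ∏ i : Fin j, d (Fin.castLE hle i) : ℕ) : ℂ) • γ) (hd : ∀ i, d i = d 0) (N : ℕ) :
    ((integralForms Φ 2).map (AddMonoidHom.mk' (fun x : E [⋀^Fin 2]→L[ℝ] ℂ ↦ γ.wedge x) (ContinuousAlternatingMap.wedge_add_right _)) ⊔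
        (integralForms Φ (2 * j + 2)).map (nsmulAddMonoidHom N)).relIndex (integralForms Φ (2 * j + 2)) = Nat.gcd N (j + 1) := by
  classical
  have hle₁ : j + 1 ≤ j + 2 := by omega
  obtain ⟨m, hmH, hm⟩ : ∃ m ∈ integralForms Φ (2 * j + 2), wedgePow (ofRealForm η) (j + 1) =
      (((j + 1).factorial * ∏ i : Fin (j + 1), d (Fin.castLE hle₁ i) : ℕ) : ℂ) • m :=
    h.exists_mem_integralForms_wedgePow_eq_content_smul Φ hle₁
  have hgen := h.map_wedge_integralForms_two_sup_zmultiples_eq_integralForms_of_eq_content_smul Φ hη hle hγ hle₁ hm (Or.inr hd)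
  have hord : ∀ k : ℤ, k • m ∈ (integralForms Φ 2).map (AddMonoidHom.mk' (fun x : E [⋀^Fin 2]→L[ℝ] ℂ ↦ γ.wedge x)
      (ContinuousAlternatingMap.wedge_add_right _)) ↔ ((j + 1 : ℕ) : ℤ) ∣ k := fun k ↦ by
    rw [← Int.cast_smul_eq_zsmul ℂ k m, h.intCast_smul_mem_map_wedge_integralForms_two_iff_of_eq_content_smul Φ hη hle hγ hle₁ hm k,
      hd (Fin.last j).castSucc, Nat.div_self (h.pos hη 0), mul_one]
  set L : (E [⋀^Fin 2]→L[ℝ] ℂ) →+ (E [⋀^Fin (2 * j + 2)]→L[ℝ] ℂ) := AddMonoidHom.mk'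
    (fun x : E [⋀^Fin 2]→L[ℝ] ℂ ↦ γ.wedge x) (ContinuousAlternatingMap.wedge_add_right _) with hL
  set S := (integralForms Φ 2).map L with hS
  set H := integralForms Φ (2 * j + 2) with hH
  -- Step 1: `S + N·H = S + ℤ·Nm`
  have hstep₁ : S ⊔ H.map (nsmulAddMonoidHom N) = S ⊔ AddSubgroup.zmultiples (N • m) := by
    refine le_antisymm (sup_le le_sup_left ?_) (sup_le le_sup_left (AddSubgroup.zmultiples_le.2 (AddSubgroup.mem_sup_right ⟨m, hmH, rfl⟩)))
    rintro _ ⟨x, hx, rfl⟩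
    rw [← hgen] at hx
    obtain ⟨s, hs, t, ht, rfl⟩ := AddSubgroup.mem_sup.1 hx
    obtain ⟨k, rfl⟩ := AddSubgroup.mem_zmultiples_iff.1 ht
    rw [nsmulAddMonoidHom_apply, smul_add, smul_comm N k m]
    exact AddSubgroup.add_mem_sup (S.nsmul_mem hs N) (AddSubgroup.mem_zmultiples_iff.2 ⟨k, rfl⟩)
  -- Step 2: `H = (S + ℤ·Nm) + ℤm`
  have hH' : H = (S ⊔ AddSubgroup.zmultiples (N • m)) ⊔ AddSubgroup.zmultiples m := by
    refine le_antisymm ?_ (sup_le (sup_le ?_ ?_) (AddSubgroup.zmultiples_le.2 hmH))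
    · rw [← hgen]
      exact sup_le_sup_right le_sup_left _
    · rw [← hgen]
      exact le_sup_left
    · exact AddSubgroup.zmultiples_le.2 (H.nsmul_mem hmH N)
  rw [hstep₁, hH', AddSubgroup.relIndex_sup_left]
  -- Step 3: pull back along `k ↦ k·m`
  set ψ : ℤ →+ (E [⋀^Fin (2 * j + 2)]→L[ℝ] ℂ) := zmultiplesHom _ m with hψ
  have hrange : AddSubgroup.zmultiples m = (⊤ : AddSubgroup ℤ).map ψ := by
    rw [← AddMonoidHom.range_eq_map, hψ, AddSubgroup.range_zmultiplesHom]
  have hgN : ((Nat.gcd N (j + 1) : ℕ) : ℤ) ∣ (N : ℤ) := Int.natCast_dvd_natCast.2 (Nat.gcd_dvd_left N (j + 1))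
  have hgj : ((Nat.gcd N (j + 1) : ℕ) : ℤ) ∣ ((j + 1 : ℕ) : ℤ) := Int.natCast_dvd_natCast.2 (Nat.gcd_dvd_right N (j + 1))
  have hcomap : (S ⊔ AddSubgroup.zmultiples (N • m)).comap ψ = AddSubgroup.zmultiples ((Nat.gcd N (j + 1) : ℕ) : ℤ) := by
    ext k
    rw [AddSubgroup.mem_comap, Int.mem_zmultiples_iff, hψ, zmultiplesHom_apply]
    constructor
    · intro hk
      obtain ⟨s, hs, t, ht, hst⟩ := AddSubgroup.mem_sup.1 hk
      obtain ⟨c, rfl⟩ := AddSubgroup.mem_zmultiples_iff.1 ht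
      have hcN : c • (N • m) = (c * (N : ℤ)) • m := by
        rw [mul_zsmul, natCast_zsmul]
      have hs' : (k - c * N) • m ∈ S := by
        have h1 : (k - c * (N : ℤ)) • m = s := by
          rw [← add_right_cancel_iff (a := c • (N • m)), hst, hcN, ← add_zsmul, sub_add_cancel]
        rw [h1]
        exact hs
      have h1 : ((Nat.gcd N (j + 1) : ℕ) : ℤ) ∣ k - c * N := hgj.trans ((hord _).1 hs')
      have h2 : ((Nat.gcd N (j + 1) : ℕ) : ℤ) ∣ c * N := hgN.mul_left c
      simpa using dvd_add h1 h2
    · rintro ⟨c, rfl⟩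
      have hbez := Nat.gcd_eq_gcd_ab N (j + 1)
      have hk : ((Nat.gcd N (j + 1) : ℕ) : ℤ) * c =
          (c * Nat.gcdB N (j + 1) * ((j + 1 : ℕ) : ℤ)) + (c * Nat.gcdA N (j + 1)) * (N : ℤ) := by
        rw [hbez]
        ring
      rw [hk, add_zsmul]
      refine AddSubgroup.add_mem_sup ((hord _).2 (Dvd.intro_left _ rfl)) (AddSubgroup.mem_zmultiples_iff.2 ⟨c * Nat.gcdA N (j + 1), ?_⟩)
      rw [mul_zsmul m (c * Nat.gcdA N (j + 1)) (N : ℤ), natCast_zsmul]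
  rw [hrange, ← AddSubgroup.relIndex_comap, hcomap, AddSubgroup.relIndex_top_right, Int.index_zmultiples, Int.natAbs_natCast]

/-- **Constant type: `γ_{g−2} ∧ H²(X, ℤ) + N·H^{2g−2}(X, ℤ) = H^{2g−2}(X, ℤ)` iff `gcd(N, g−1) = 1`** (`g = j + 2`; any `N`, not only primes):
the Lefschetz operator of the minimal class on `H²(X, ℤ/N)` is onto iff `N` is prime to `g − 1`.
[cite: Lange2023AbelianVarietiesComplex, §5.4.1 (5.22) (PDF p. 275); §2.1.1] [cite: VoisinHodgeI2002, §7.1.2 (PDF p. 134 L31)] -/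
theorem IsSymplecticEnum.map_wedge_integralForms_two_sup_map_nsmul_eq_iff_coprime_of_forall_eq (h : IsSymplecticEnum Φ e₀ η d)
    (hη : IsRiemannForm Φ η) (hle : j ≤ j + 2) {γ : E [⋀^Fin (2 * j)]→L[ℝ] ℂ}
    (hγ : wedgePow (ofRealForm η) j = ((j.factorial * ∏ i : Fin j, d (Fin.castLE hle i) : ℕ) : ℂ) • γ) (hd : ∀ i, d i = d 0) (N : ℕ) :
    (integralForms Φ 2).map (AddMonoidHom.mk' (fun x : E [⋀^Fin 2]→L[ℝ] ℂ ↦ γ.wedge x) (ContinuousAlternatingMap.wedge_add_right _)) ⊔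
        (integralForms Φ (2 * j + 2)).map (nsmulAddMonoidHom N) = integralForms Φ (2 * j + 2) ↔ Nat.Coprime N (j + 1) := by
  rw [Nat.Coprime, ← h.relIndex_map_wedge_integralForms_two_sup_map_nsmul_of_forall_eq Φ hη hle hγ hd N, AddSubgroup.relIndex_eq_one]
  refine ⟨fun heq ↦ heq.ge, fun hle' ↦ le_antisymm (sup_le (h.map_wedge_integralForms_two_le_of_eq_content_smul Φ hη hle hγ) ?_) hle'⟩
  rintro _ ⟨x, hx, rfl⟩
  exact (integralForms Φ (2 * j + 2)).nsmul_mem hx N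

/-! ## §3 Constant type, `p ∣ g − 1`: the kernel of `γ_{g−2} ∪ (−)` on `H²(X, ℤ/p)` is the line of `θ` -/

/-- **Constant type, `p` prime, `p ∣ g − 1`: `[K_p : p·H²(X, ℤ)] = p`** where `K_p = {x ∈ H²(X, ℤ) : γ_{g−2} ∧ x ∈ p·H^{2g−2}(X, ℤ)}` (`g = j + 2`) —
the kernel of `γ_{g−2} ∪ (−) : H²(X, ℤ/p) → H^{2g−2}(X, ℤ/p)` is ONE-dimensional: `[H² : K_p] = [γ∧H² + pH : pH] = p^{C(2g,2)}/[H : γ∧H² + pH]`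
and `[H : γ∧H² + pH] = gcd(p, g−1) = p` (§2). [cite: Lange2023AbelianVarietiesComplex, §5.4.1 Thm. 5.4.1 and (5.22) (PDF p. 275); §2.5.3 Cor. 2.5.17 (PDF p. 135); §1.1.3 Exercise 1.1.6 (8); §2.1.1] [cite: VoisinHodgeI2002, §6.2.3 Thm. 6.25 (PDF p. 125); §7.1.2 (PDF p. 134 L31)] -/
theorem IsSymplecticEnum.relIndex_map_nsmul_inf_comap_of_forall_eq (h : IsSymplecticEnum Φ e₀ η d)
    (hη : IsRiemannForm Φ η) (hle : j ≤ j + 2) {γ : E [⋀^Fin (2 * j)]→L[ℝ] ℂ}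
    (hγ : wedgePow (ofRealForm η) j = ((j.factorial * ∏ i : Fin j, d (Fin.castLE hle i) : ℕ) : ℂ) • γ) (hd : ∀ i, d i = d 0)
    {p : ℕ} (hp : p.Prime) (hpj : p ∣ j + 1) :
    ((integralForms Φ 2).map (nsmulAddMonoidHom p)).relIndex
      (integralForms Φ 2 ⊓ ((integralForms Φ (2 * j + 2)).map (nsmulAddMonoidHom p)).comap
        (AddMonoidHom.mk' (fun x : E [⋀^Fin 2]→L[ℝ] ℂ ↦ γ.wedge x) (ContinuousAlternatingMap.wedge_add_right _))) = p := by
  classical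
  have hc := h.relIndex_map_wedge_integralForms_two_sup_map_nsmul_of_forall_eq Φ hη hle hγ hd p
  rw [Nat.gcd_eq_left hpj] at hc
  set L : (E [⋀^Fin 2]→L[ℝ] ℂ) →+ (E [⋀^Fin (2 * j + 2)]→L[ℝ] ℂ) := AddMonoidHom.mk'
    (fun x : E [⋀^Fin 2]→L[ℝ] ℂ ↦ γ.wedge x) (ContinuousAlternatingMap.wedge_add_right _) with hL
  set H₂ := integralForms Φ 2 with hH₂
  set H := integralForms Φ (2 * j + 2) with hH
  set S := H₂.map L with hS
  set pH := H.map (nsmulAddMonoidHom p) with hpH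
  set pH₂ := H₂.map (nsmulAddMonoidHom p) with hpH₂
  have hSH : S ≤ H := h.map_wedge_integralForms_two_le_of_eq_content_smul Φ hη hle hγ
  have hpHH : pH ≤ H := by
    rintro _ ⟨x, hx, rfl⟩
    exact H.nsmul_mem hx p
  have hpH₂K : pH₂ ≤ H₂ ⊓ pH.comap L := by
    rintro _ ⟨x, hx, rfl⟩
    refine AddSubgroup.mem_inf.2 ⟨H₂.nsmul_mem hx p, ?_⟩
    rw [AddSubgroup.mem_comap, nsmulAddMonoidHom_apply, map_nsmul]
    exact ⟨L x, hSH ⟨x, hx, rfl⟩, rfl⟩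
  have hpow : p ^ (Fintype.card ι).choose 2 ≠ 0 := pow_ne_zero _ hp.ne_zero
  have hidx₂ : pH₂.relIndex H₂ = p ^ (Fintype.card ι).choose 2 := relIndex_map_nsmul_integralForms_two₄₃ Φ p
  have hidx : pH.relIndex H = p ^ (Fintype.card ι).choose 2 := relIndex_map_nsmul_integralForms_codegree_two₄₃ Φ (ilvEnum e₀) p
  have hKidx : (H₂ ⊓ pH.comap L).relIndex H₂ = pH.relIndex (S ⊔ pH) := by
    rw [relIndex_inf_comap₄₃, AddSubgroup.relIndex_sup_right]
  have hmul₁ : pH.relIndex (S ⊔ pH) * p = p ^ (Fintype.card ι).choose 2 := by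
    rw [← hidx, ← hc, AddSubgroup.relIndex_mul_relIndex pH (S ⊔ pH) H le_sup_right (sup_le hSH hpHH)]
  have hmul₂ : pH₂.relIndex (H₂ ⊓ pH.comap L) * (H₂ ⊓ pH.comap L).relIndex H₂ = p ^ (Fintype.card ι).choose 2 := by
    rw [AddSubgroup.relIndex_mul_relIndex pH₂ (H₂ ⊓ pH.comap L) H₂ hpH₂K inf_le_left, hidx₂]
  rw [hKidx] at hmul₂
  have hA : pH.relIndex (S ⊔ pH) ≠ 0 := fun h0 ↦ hpow (by rw [← hmul₁, h0, zero_mul])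
  refine Nat.eq_of_mul_eq_mul_right (Nat.pos_of_ne_zero hA) ?_
  rw [hmul₂, ← hmul₁, mul_comm]

/-- **The minimal class kills the polarisation modulo `g − 1`: `γ_{g−2} ∧ (θ/d₁) = (g−1) · γ_{g−1}` for a constant type** (`g = j + 2`;
`γ_{g−2} ∧ θ = (g−1)·d_{g−1}·γ_{g−1}` in general, g40-#6). [cite: Lange2023AbelianVarietiesComplex, §2.5.3 Thm. 2.5.16 and Cor. 2.5.17 (PDF p. 135); §1.5.1 (PDF p. 51)] -/
theorem IsSymplecticEnum.wedge_inv_smul_ofRealForm_eq_nsmul_of_forall_eq (h : IsSymplecticEnum Φ e₀ η d) (hη : IsRiemannForm Φ η)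
    (hle : j ≤ j + 2) {γ : E [⋀^Fin (2 * j)]→L[ℝ] ℂ}
    (hγ : wedgePow (ofRealForm η) j = ((j.factorial * ∏ i : Fin j, d (Fin.castLE hle i) : ℕ) : ℂ) • γ) (hd : ∀ i, d i = d 0)
    (hle₁ : j + 1 ≤ j + 2) {m : E [⋀^Fin (2 * j + 2)]→L[ℝ] ℂ}
    (hm : wedgePow (ofRealForm η) (j + 1) = (((j + 1).factorial * ∏ i : Fin (j + 1), d (Fin.castLE hle₁ i) : ℕ) : ℂ) • m) :
    γ.wedge ((((d 0 : ℕ) : ℂ))⁻¹ • ofRealForm η) = (j + 1) • m := by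
  have hd0 : ((d 0 : ℕ) : ℂ) ≠ 0 := by exact_mod_cast (h.pos hη 0).ne'
  rw [wedge_smul_right_complex, h.wedge_ofRealForm_eq_smul_of_eq_content_smul Φ hη hle hγ hle₁ hm, smul_smul,
    hd (Fin.last j).castSucc, Nat.cast_mul, mul_comm (((j + 1 : ℕ) : ℂ)) _, ← mul_assoc, inv_mul_cancel₀ hd0, one_mul]
  exact Nat.cast_smul_eq_nsmul ℂ (j + 1) m

/-- **Constant type, `p` prime, `p ∣ g − 1`: the kernel of `γ_{g−2} ∪ (−)` on `H²(X, ℤ/p)` is the LINE OF THE POLARISATION: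
`{x ∈ H²(X, ℤ) : γ_{g−2} ∧ x ∈ p·H^{2g−2}(X, ℤ)} = ℤ·(θ/d₁) + p·H²(X, ℤ)`** (`g = j + 2`; `θ/d₁ ∈ H²(X, ℤ)` is primitive — its value on
`(λ₁, μ₁)` is `1` — and `γ_{g−2} ∧ θ/d₁ = (g−1)·γ_{g−1} ∈ p·H^{2g−2}(X, ℤ)`; both sides contain `p·H²(X, ℤ)` with index `p`, the left by the
index count `[K_p : pH²] = p`). For a principally polarised `X` of dimension `g ≥ 3` and `p ∣ g − 1`:
`ker (θ^{g−2}/(g−2)! ∪ (−) : H²(X, 𝔽_p) → H^{2g−2}(X, 𝔽_p)) = 𝔽_p · θ̄`. [cite: Lange2023AbelianVarietiesComplex, §5.4.1 Thm. 5.4.1 and (5.22) (PDF p. 275); §2.5.3 Thm. 2.5.16 and Cor. 2.5.17 (PDF p. 135); §4.2 (PDF p. 204); §1.5.1 (PDF p. 51); §1.1.3 Lemma 1.1.17; §2.1.1] [cite: VoisinHodgeI2002, §6.2.3 Thm. 6.25 (PDF p. 125); §7.1.2 (PDF p. 134 L31)] [cite: BenoistDebarre2023SmoothSubvarietiesJacobians,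 §1 (p. 3)] -/
theorem IsSymplecticEnum.inf_comap_map_nsmul_eq_zmultiples_sup_of_forall_eq (h : IsSymplecticEnum Φ e₀ η d)
    (hη : IsRiemannForm Φ η) (hle : j ≤ j + 2) {γ : E [⋀^Fin (2 * j)]→L[ℝ] ℂ}
    (hγ : wedgePow (ofRealForm η) j = ((j.factorial * ∏ i : Fin j, d (Fin.castLE hle i) : ℕ) : ℂ) • γ) (hd : ∀ i, d i = d 0)
    {p : ℕ} (hp : p.Prime) (hpj : p ∣ j + 1) :
    integralForms Φ 2 ⊓ ((integralForms Φ (2 * j + 2)).map (nsmulAddMonoidHom p)).comap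
        (AddMonoidHom.mk' (fun x : E [⋀^Fin 2]→L[ℝ] ℂ ↦ γ.wedge x) (ContinuousAlternatingMap.wedge_add_right _)) =
      AddSubgroup.zmultiples ((((d 0 : ℕ) : ℂ))⁻¹ • ofRealForm η) ⊔ (integralForms Φ 2).map (nsmulAddMonoidHom p) := by
  classical
  have hle₁ : j + 1 ≤ j + 2 := by omega
  obtain ⟨m, hmH, hm⟩ : ∃ m ∈ integralForms Φ (2 * j + 2), wedgePow (ofRealForm η) (j + 1) =
      (((j + 1).factorial * ∏ i : Fin (j + 1), d (Fin.castLE hle₁ i) : ℕ) : ℂ) • m :=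
    h.exists_mem_integralForms_wedgePow_eq_content_smul Φ hle₁
  have hKp := h.relIndex_map_nsmul_inf_comap_of_forall_eq Φ hη hle hγ hd hp hpj
  have hγθ' := h.wedge_inv_smul_ofRealForm_eq_nsmul_of_forall_eq Φ hη hle hγ hd hle₁ hm
  have hθ'Z := h.inv_smul_ofRealForm_mem_integralForms_two Φ hη
  set L : (E [⋀^Fin 2]→L[ℝ] ℂ) →+ (E [⋀^Fin (2 * j + 2)]→L[ℝ] ℂ) := AddMonoidHom.mk'
    (fun x : E [⋀^Fin 2]→L[ℝ] ℂ ↦ γ.wedge x) (ContinuousAlternatingMap.wedge_add_right _) with hL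
  set H₂ := integralForms Φ 2 with hH₂
  set H := integralForms Φ (2 * j + 2) with hH
  set S := H₂.map L with hS
  set pH := H.map (nsmulAddMonoidHom p) with hpH
  set pH₂ := H₂.map (nsmulAddMonoidHom p) with hpH₂
  set θ' : E [⋀^Fin 2]→L[ℝ] ℂ := (((d 0 : ℕ) : ℂ))⁻¹ • ofRealForm η with hθ'
  have hd0 : ((d 0 : ℕ) : ℂ) ≠ 0 := by exact_mod_cast (h.pos hη 0).ne'
  have hθ'H₂ : θ' ∈ H₂ := hθ'Z
  have hSH : S ≤ H := h.map_wedge_integralForms_two_le_of_eq_content_smul Φ hη hle hγ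
  have hpH₂K : pH₂ ≤ H₂ ⊓ pH.comap L := by
    rintro _ ⟨x, hx, rfl⟩
    refine AddSubgroup.mem_inf.2 ⟨H₂.nsmul_mem hx p, ?_⟩
    rw [AddSubgroup.mem_comap, nsmulAddMonoidHom_apply, map_nsmul]
    exact ⟨L x, hSH ⟨x, hx, rfl⟩, rfl⟩
  -- `θ' ∈ K_p`: `γ ∧ θ' = (j+1)·m ∈ p·H`
  have hθ'K : θ' ∈ H₂ ⊓ pH.comap L := by
    refine AddSubgroup.mem_inf.2 ⟨hθ'H₂, ?_⟩
    rw [AddSubgroup.mem_comap, hL, AddMonoidHom.mk'_apply, hγθ']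
    obtain ⟨c, hc⟩ := hpj
    refine ⟨c • m, H.nsmul_mem hmH c, ?_⟩
    rw [nsmulAddMonoidHom_apply, ← mul_nsmul, mul_comm c p, ← hc]
  have hTK : AddSubgroup.zmultiples θ' ⊔ pH₂ ≤ H₂ ⊓ pH.comap L := sup_le (AddSubgroup.zmultiples_le.2 hθ'K) hpH₂K
  -- `[ℤθ' + pH₂ : pH₂] = p` (`θ'(λ₁, μ₁) = 1`)
  have hTp : pH₂.relIndex (AddSubgroup.zmultiples θ' ⊔ pH₂) = p := by
    rw [sup_comm, AddSubgroup.relIndex_sup_left]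
    set ψ : ℤ →+ (E [⋀^Fin 2]→L[ℝ] ℂ) := zmultiplesHom _ θ' with hψ
    have hrange : AddSubgroup.zmultiples θ' = (⊤ : AddSubgroup ℤ).map ψ := by
      rw [← AddMonoidHom.range_eq_map, hψ, AddSubgroup.range_zmultiplesHom]
    have hθ'1 : θ' ![Φ (Pi.single (e₀ (Sum.inl 0)) 1), Φ (Pi.single (e₀ (Sum.inr 0)) 1)] = 1 := by
      rw [hθ', ContinuousAlternatingMap.smul_apply, h.ofRealForm_apply_pair Φ, smul_eq_mul, inv_mul_cancel₀ hd0]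
    have hcomap : pH₂.comap ψ = AddSubgroup.zmultiples (p : ℤ) := by
      ext k
      rw [AddSubgroup.mem_comap, Int.mem_zmultiples_iff, hψ, zmultiplesHom_apply]
      constructor
      · rintro ⟨y, hy, hyk⟩
        obtain ⟨z, hz⟩ := exists_int_apply_pair_of_mem_integralForms_two Φ hy (e₀ (Sum.inl 0)) (e₀ (Sum.inr 0))
        have hyk' : (p : ℂ) • y = (k : ℂ) • θ' :=
          (Nat.cast_smul_eq_nsmul ℂ p y).trans (hyk.trans (Int.cast_smul_eq_zsmul ℂ k θ').symm)
        have hev := congrArg (fun f : E [⋀^Fin 2]→L[ℝ] ℂ ↦ f ![Φ (Pi.single (e₀ (Sum.inl 0)) 1), Φ (Pi.single (e₀ (Sum.inr 0)) 1)]) hyk'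
        simp only [ContinuousAlternatingMap.smul_apply, hz, hθ'1, smul_eq_mul, mul_one] at hev
        refine ⟨z, ?_⟩
        exact_mod_cast hev.symm
      · rintro ⟨c, rfl⟩
        refine ⟨c • θ', H₂.zsmul_mem hθ'H₂ c, ?_⟩
        rw [nsmulAddMonoidHom_apply, mul_zsmul, natCast_zsmul]
    rw [hrange, ← AddSubgroup.relIndex_comap, hcomap, AddSubgroup.relIndex_top_right, Int.index_zmultiples, Int.natAbs_natCast]
  -- compare indices
  have hmul := AddSubgroup.relIndex_mul_relIndex pH₂ (AddSubgroup.zmultiples θ' ⊔ pH₂) (H₂ ⊓ pH.comap L) le_sup_right hTK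
  rw [hTp, hKp] at hmul
  have h1 : (AddSubgroup.zmultiples θ' ⊔ pH₂).relIndex (H₂ ⊓ pH.comap L) = 1 :=
    Nat.eq_of_mul_eq_mul_left hp.pos (hmul.trans (mul_one p).symm)
  exact le_antisymm (AddSubgroup.relIndex_eq_one.1 h1) hTK

/-- **Membership form** (constant type, `p` prime, `p ∣ g − 1`, `g = j + 2`): for `x ∈ H²(X, ℤ)`,
`γ_{g−2} ∧ x ∈ p·H^{2g−2}(X, ℤ)` iff `x = k·(θ/d₁) + p·y` for some `k ∈ ℤ` and `y ∈ H²(X, ℤ)`.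
[cite: Lange2023AbelianVarietiesComplex, §5.4.1 Thm. 5.4.1 and (5.22) (PDF p. 275); §1.5.1 (PDF p. 51); §2.1.1] [cite: VoisinHodgeI2002, §7.1.2 (PDF p. 134 L31)] -/
theorem IsSymplecticEnum.wedge_mem_map_nsmul_iff_of_forall_eq (h : IsSymplecticEnum Φ e₀ η d)
    (hη : IsRiemannForm Φ η) (hle : j ≤ j + 2) {γ : E [⋀^Fin (2 * j)]→L[ℝ] ℂ}
    (hγ : wedgePow (ofRealForm η) j = ((j.factorial * ∏ i : Fin j, d (Fin.castLE hle i) : ℕ) : ℂ) • γ) (hd : ∀ i, d i = d 0)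
    {p : ℕ} (hp : p.Prime) (hpj : p ∣ j + 1) {x : E [⋀^Fin 2]→L[ℝ] ℂ} (hx : x ∈ integralForms Φ 2) :
    γ.wedge x ∈ (integralForms Φ (2 * j + 2)).map (nsmulAddMonoidHom p) ↔
      ∃ (k : ℤ) (y : E [⋀^Fin 2]→L[ℝ] ℂ), y ∈ integralForms Φ 2 ∧ x = k • ((((d 0 : ℕ) : ℂ))⁻¹ • ofRealForm η) + p • y := by
  have hK := h.inf_comap_map_nsmul_eq_zmultiples_sup_of_forall_eq Φ hη hle hγ hd hp hpj
  have hmem : x ∈ integralForms Φ 2 ⊓ ((integralForms Φ (2 * j + 2)).map (nsmulAddMonoidHom p)).comap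
      (AddMonoidHom.mk' (fun x : E [⋀^Fin 2]→L[ℝ] ℂ ↦ γ.wedge x) (ContinuousAlternatingMap.wedge_add_right _)) ↔
      γ.wedge x ∈ (integralForms Φ (2 * j + 2)).map (nsmulAddMonoidHom p) := by
    rw [AddSubgroup.mem_inf, AddSubgroup.mem_comap, AddMonoidHom.mk'_apply]
    exact ⟨fun h1 ↦ h1.2, fun h1 ↦ ⟨hx, h1⟩⟩
  rw [← hmem, hK, AddSubgroup.mem_sup]
  constructor
  · rintro ⟨s, hs, t, ht, rfl⟩
    obtain ⟨k, rfl⟩ := AddSubgroup.mem_zmultiples_iff.1 hs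
    obtain ⟨y, hy, rfl⟩ := ht
    exact ⟨k, y, hy, rfl⟩
  · rintro ⟨k, y, hy, rfl⟩
    exact ⟨_, AddSubgroup.mem_zmultiples_iff.2 ⟨k, rfl⟩, _, ⟨y, hy, rfl⟩, rfl⟩

/-- **Constant type, `p ∣ g − 1`: the kernel modulo `p` is NOT trivial** — `γ_{g−2} ∪ (−)` is not injective on `H²(X, ℤ/p)`
(`θ/d₁ ∉ p·H²(X, ℤ)` lies in it); complements §1 (injective iff `p ∤ g − 1`, for a constant type `d_g/d₁ = 1`).
[cite: Lange2023AbelianVarietiesComplex, §5.4.1 (5.22) (PDF p. 275); §2.1.1] [cite: VoisinHodgeI2002, §7.1.2 (PDF p. 134 L31)] -/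
theorem IsSymplecticEnum.inf_comap_map_nsmul_ne_map_nsmul_of_forall_eq (h : IsSymplecticEnum Φ e₀ η d)
    (hη : IsRiemannForm Φ η) (hle : j ≤ j + 2) {γ : E [⋀^Fin (2 * j)]→L[ℝ] ℂ}
    (hγ : wedgePow (ofRealForm η) j = ((j.factorial * ∏ i : Fin j, d (Fin.castLE hle i) : ℕ) : ℂ) • γ) (hd : ∀ i, d i = d 0)
    {p : ℕ} (hp : p.Prime) (hpj : p ∣ j + 1) :
    integralForms Φ 2 ⊓ ((integralForms Φ (2 * j + 2)).map (nsmulAddMonoidHom p)).comap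
        (AddMonoidHom.mk' (fun x : E [⋀^Fin 2]→L[ℝ] ℂ ↦ γ.wedge x) (ContinuousAlternatingMap.wedge_add_right _)) ≠
      (integralForms Φ 2).map (nsmulAddMonoidHom p) := fun heq ↦ by
  have hKp := h.relIndex_map_nsmul_inf_comap_of_forall_eq Φ hη hle hγ hd hp hpj
  rw [heq, AddSubgroup.relIndex_self] at hKp
  exact hp.one_lt.ne hKp

/-! ## §4 Basis-free forms: any presentation of a polarised torus of type `(d₁, …, d_g)` -/

/-- **Any presentation, every type, `g ≥ 3`: `γ_{g−2} ∪ (−)` is injective on `H²(X, ℤ/p)` iff `p ∤ g − 1` and `p ∤ d_g/d₁`.**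
[cite: Lange2023AbelianVarietiesComplex, §1.5.1 (PDF p. 51); §5.4.1 Thm. 5.4.1 and (5.22) (PDF p. 275); §2.5.3 Cor. 2.5.17 (PDF p. 135)] [cite: VoisinHodgeI2002, §7.1.2 (PDF p. 134 L31)] -/
theorem IsPolarizationType.inf_comap_map_nsmul_eq_map_nsmul_iff_of_eq_content_smul {Φ : (ι → ℝ) ≃L[ℝ] E}
    (hd : IsPolarizationType Φ η d) (hη : IsRiemannForm Φ η) (hj : 1 ≤ j) (hle : j ≤ j + 2) {γ : E [⋀^Fin (2 * j)]→L[ℝ] ℂ}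
    (hγ : wedgePow (ofRealForm η) j = ((j.factorial * ∏ i : Fin j, d (Fin.castLE hle i) : ℕ) : ℂ) • γ) {p : ℕ} (hp : p.Prime) :
    integralForms Φ 2 ⊓ ((integralForms Φ (2 * j + 2)).map (nsmulAddMonoidHom p)).comap
        (AddMonoidHom.mk' (fun x : E [⋀^Fin 2]→L[ℝ] ℂ ↦ γ.wedge x) (ContinuousAlternatingMap.wedge_add_right _)) =
      (integralForms Φ 2).map (nsmulAddMonoidHom p) ↔ ¬ p ∣ j + 1 ∧ ¬ p ∣ d (Fin.last (j + 1)) / d 0 := by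
  obtain ⟨Φ', hΛ, hs⟩ := hd.exists_isSymplecticEnum Φ
  rw [integralForms_eq_of_range_latticeVec_eq hΛ.symm 2, integralForms_eq_of_range_latticeVec_eq hΛ.symm (2 * j + 2)]
  exact hs.inf_comap_map_nsmul_eq_map_nsmul_iff_of_eq_content_smul Φ' (hη.of_range_latticeVec_subset hΛ.le) hj hle hγ hp

/-- **Any presentation, constant type: `[H^{2g−2}(X, ℤ) : γ_{g−2} ∧ H²(X, ℤ) + N·H^{2g−2}(X, ℤ)] = gcd(N, g−1)`** (`g = j + 2`), e.g. for every
principally polarised complex torus. [cite: Lange2023AbelianVarietiesComplex, §1.5.1 (PDF p. 51); §5.4.1 (5.22) (PDF p. 275); §4.2 (PDF p. 204); §2.1.1] [cite: VoisinHodgeI2002, §7.1.2 (PDF p. 134 L31)] [cite: BenoistDebarre2023SmoothSubvarietiesJacobians, §1 (p. 3)] -/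
theorem IsPolarizationType.relIndex_map_wedge_integralForms_two_sup_map_nsmul_of_forall_eq {Φ : (ι → ℝ) ≃L[ℝ] E}
    (hd : IsPolarizationType Φ η d) (hη : IsRiemannForm Φ η) (hle : j ≤ j + 2) {γ : E [⋀^Fin (2 * j)]→L[ℝ] ℂ}
    (hγ : wedgePow (ofRealForm η) j = ((j.factorial * ∏ i : Fin j, d (Fin.castLE hle i) : ℕ) : ℂ) • γ) (hd₀ : ∀ i, d i = d 0)
    (N : ℕ) :
    ((integralForms Φ 2).map (AddMonoidHom.mk' (fun x : E [⋀^Fin 2]→L[ℝ] ℂ ↦ γ.wedge x) (ContinuousAlternatingMap.wedge_add_right _)) ⊔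
        (integralForms Φ (2 * j + 2)).map (nsmulAddMonoidHom N)).relIndex (integralForms Φ (2 * j + 2)) = Nat.gcd N (j + 1) := by
  obtain ⟨Φ', hΛ, hs⟩ := hd.exists_isSymplecticEnum Φ
  rw [integralForms_eq_of_range_latticeVec_eq hΛ.symm 2, integralForms_eq_of_range_latticeVec_eq hΛ.symm (2 * j + 2)]
  exact hs.relIndex_map_wedge_integralForms_two_sup_map_nsmul_of_forall_eq Φ' (hη.of_range_latticeVec_subset hΛ.le) hle hγ hd₀ N

/-- **Any presentation, constant type, `p` prime, `p ∣ g − 1`: the kernel of `γ_{g−2} ∪ (−)` on `H²(X, ℤ/p)` is the line of `θ`: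
`{x ∈ H²(X, ℤ) : γ_{g−2} ∧ x ∈ p·H^{2g−2}(X, ℤ)} = ℤ·(θ/d₁) + p·H²(X, ℤ)`** (`g = j + 2`).
[cite: Lange2023AbelianVarietiesComplex, §1.5.1 (PDF p. 51); §5.4.1 Thm. 5.4.1 and (5.22) (PDF p. 275); §2.5.3 Cor. 2.5.17 (PDF p. 135); §2.1.1] [cite: VoisinHodgeI2002, §6.2.3 Thm. 6.25 (PDF p. 125); §7.1.2 (PDF p. 134 L31)] [cite: BenoistDebarre2023SmoothSubvarietiesJacobians, §1 (p. 3)] -/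
theorem IsPolarizationType.inf_comap_map_nsmul_eq_zmultiples_sup_of_forall_eq {Φ : (ι → ℝ) ≃L[ℝ] E}
    (hd : IsPolarizationType Φ η d) (hη : IsRiemannForm Φ η) (hle : j ≤ j + 2) {γ : E [⋀^Fin (2 * j)]→L[ℝ] ℂ}
    (hγ : wedgePow (ofRealForm η) j = ((j.factorial * ∏ i : Fin j, d (Fin.castLE hle i) : ℕ) : ℂ) • γ) (hd₀ : ∀ i, d i = d 0)
    {p : ℕ} (hp : p.Prime) (hpj : p ∣ j + 1) :
    integralForms Φ 2 ⊓ ((integralForms Φ (2 * j + 2)).map (nsmulAddMonoidHom p)).comap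
        (AddMonoidHom.mk' (fun x : E [⋀^Fin 2]→L[ℝ] ℂ ↦ γ.wedge x) (ContinuousAlternatingMap.wedge_add_right _)) =
      AddSubgroup.zmultiples ((((d 0 : ℕ) : ℂ))⁻¹ • ofRealForm η) ⊔ (integralForms Φ 2).map (nsmulAddMonoidHom p) := by
  obtain ⟨Φ', hΛ, hs⟩ := hd.exists_isSymplecticEnum Φ
  rw [integralForms_eq_of_range_latticeVec_eq hΛ.symm 2, integralForms_eq_of_range_latticeVec_eq hΛ.symm (2 * j + 2)]
  exact hs.inf_comap_map_nsmul_eq_zmultiples_sup_of_forall_eq Φ' (hη.of_range_latticeVec_subset hΛ.le) hle hγ hd₀ hp hpj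

/-- **Existence form, constant type, `p ∣ g − 1`: any polarised torus of constant type carries the integral minimal class `γ_{g−2}` with
`{x ∈ H²(X, ℤ) : γ_{g−2} ∧ x ∈ p·H^{2g−2}(X, ℤ)} = ℤ·(θ/d₁) + p·H²(X, ℤ)`** (`g = j + 2`).
[cite: Lange2023AbelianVarietiesComplex, §2.5.3 Thm. 2.5.16 and Cor. 2.5.17 (PDF p. 135); §5.4.1 (5.22) (PDF p. 275); §2.1.1] [cite: BenoistDebarre2023SmoothSubvarietiesJacobians, §1 (p. 3)] -/
theorem IsPolarizationType.exists_minimalClass_inf_comap_map_nsmul_eq_zmultiples_sup {Φ : (ι → ℝ) ≃L[ℝ] E}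
    (hd : IsPolarizationType Φ η d) (hη : IsRiemannForm Φ η) (hle : j ≤ j + 2) (hd₀ : ∀ i, d i = d 0) {p : ℕ} (hp : p.Prime)
    (hpj : p ∣ j + 1) :
    ∃ γ ∈ integralForms Φ (2 * j), wedgePow (ofRealForm η) j = ((j.factorial * ∏ i : Fin j, d (Fin.castLE hle i) : ℕ) : ℂ) • γ ∧
      integralForms Φ 2 ⊓ ((integralForms Φ (2 * j + 2)).map (nsmulAddMonoidHom p)).comap
          (AddMonoidHom.mk' (fun x : E [⋀^Fin 2]→L[ℝ] ℂ ↦ γ.wedge x) (ContinuousAlternatingMap.wedge_add_right _)) =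
        AddSubgroup.zmultiples ((((d 0 : ℕ) : ℂ))⁻¹ • ofRealForm η) ⊔ (integralForms Φ 2).map (nsmulAddMonoidHom p) := by
  obtain ⟨γ, hγZ, hγ⟩ := hd.exists_mem_integralForms_wedgePow_eq_content_smul hle
  exact ⟨γ, hγZ, hγ, hd.inf_comap_map_nsmul_eq_zmultiples_sup_of_forall_eq hη hle hγ hd₀ hp hpj⟩

end ModPrimeKernel

end Literature.Geometry.Kaehler.ComplexTorus
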